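import Summits.CriticalPhenomena.SAWScalingLimit.Theorems.SAWDefectDecoherenceBoundaryClosureRInnerPolygonsSuperHexagons
import HarnessLib

/-!
# Crux `BoundaryClosureR` (stmt-CriticalPhenomena-14004), line `polygon-parity-squeeze`,
# stub `stub_innerPolygons` (IP): gluing a grid TRAPEZOID to a union of super-hexagon tiles keeps
# the cell set pinch-free

Landing target:
`Summits/CriticalPhenomena/SAWScalingLimit/Theorems/SAWDefectDecoherenceBoundaryClosureRInnerPolygonsTrapezoid.lean`
(`--supports stmt-CriticalPhenomena-14004`; FACT 1 of the inner-polygon construction, pin part).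

The cell set of the inner polygon is `K = tileFaces S ∪ R₁ ∪ R₀`: super-hexagon tiles deep inside
`Ω` and, on each flat pin, a GRID TRAPEZOID `R` — the faces all of whose vertices `v` satisfy
`0 ≤ v₁ ≤ H`, `-a ≤ v₀`, `v₀ + v₁ ≤ b` (base `[-a, b]` on the pin row, `60°` base corners, top row
`H`, `120°` top corners).  `trapezoid_union_tiles_noPinch`: the union `tileFaces S ∪ R` satisfies the
no-pinch hypothesis of `boundaryWalk_vertexSimple` provided NO tile face sits at the two base corners
and ALL six faces sit in tiles at the two top corners (in the construction: tiles are `η'`-deep, the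
base is on `∂Ω`, the top is `3η'`-deep).  Proof: at a vertex off the closed trapezoid only tiles
matter (`superHexagons_noPinch`); at a vertex of it, which neighbours leave the trapezoid is read off
four tightness bits (`v₁ = 0`, `v₁ = H`, `v₀ = -a`, `v₀ + v₁ = b`), the tiles contribute a block
pattern (`tile_pattern`), and the finitely many combined patterns switch off at most once
(`trapezoid_switch_le_one`, `decide`d — the geometric content: along a grid line a tile either has an
edge on it or is crossed by it).

Sources: folklore.  No proposition is defined and no named fact is introduced.
-/

noncomputable section

open scoped Classical
open Literature.Probability.LatticeModels
open Literature.Probability.Percolation (triDir)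
open Literature.Probability.RandomPlanarGeometry.SAW (site_two_eq_iff)

namespace Summit.CriticalPhenomena.SAWScalingLimit.Theorems.PolygonParitySqueeze.BoundaryWalk

/-- **The combined patterns switch off at most once** (`decide`d).  Tightness bits `t0, tH, tL, tR`
(not both `t0, tH`; not both `tL, tR`), the neighbour `k` leaving the trapezoid iff
`fail k = (t0 ∧ k ∈ {4,5}) ∨ (tH ∧ k ∈ {1,2}) ∨ (tL ∧ k ∈ {2,3}) ∨ (tR ∧ k ∈ {0,1})`, the trapezoid
owning the face `k` iff neither `k` nor `k+1` fails, a tile block pattern `T` vanishing at the base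
corners and full at the top corners: the union pattern has at most one `true → false` switch.
[folklore] -/
theorem trapezoid_switch_le_one (t0 tH tL tR : Bool) (T : Fin 6 → Bool)
    (hT : (∀ k, T k = T 0) ∨ (T 0 = T 1 ∧ T 2 = T 3 ∧ T 4 = T 5) ∨ (T 5 = T 0 ∧ T 1 = T 2 ∧ T 3 = T 4))
    (h0H : (t0 && tH) = false) (hLR : (tL && tR) = false)
    (hcb : (t0 && (tL || tR)) = true → ∀ k, T k = false)
    (hct : (tH && (tL || tR)) = true → ∀ k, T k = true) :
    (Finset.univ.filter fun k : Fin 6 =>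
      (T k || (!((t0 && ![false, false, false, false, true, true] k) ||
          (tH && ![false, true, true, false, false, false] k) ||
          (tL && ![false, false, true, true, false, false] k) ||
          (tR && ![true, true, false, false, false, false] k)) &&
        !((t0 && ![false, false, false, false, true, true] (k + 1)) ||
          (tH && ![false, true, true, false, false, false] (k + 1)) ||
          (tL && ![false, false, true, true, false, false] (k + 1)) ||
          (tR && ![true, true, false, false, false, false] (k + 1))))) = true ∧
      (T (k + 1) || (!((t0 && ![false, false, false, false, true, true] (k + 1)) ||
          (tH && ![false, true, true, false, false, false] (k + 1)) ||
          (tL && ![false, false, true, true, false, false] (k + 1)) ||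
          (tR && ![true, true, false, false, false, false] (k + 1))) &&
        !((t0 && ![false, false, false, false, true, true] (k + 1 + 1)) ||
          (tH && ![false, true, true, false, false, false] (k + 1 + 1)) ||
          (tL && ![false, false, true, true, false, false] (k + 1 + 1)) ||
          (tR && ![true, true, false, false, false, false] (k + 1 + 1))))) = false).card ≤ 1 := by
  revert t0 tH tL tR T
  decide

/-- **The switch count at a vertex only sees the six faces round it**: two face sets which agree on
`faceL y 0, …, faceL y 5` have the same number of anticlockwise switches at `y` (how the no-pinch
counts of `tileFaces S ∪ R₁ ∪ R₀` are localised to one trapezoid at a time). [folklore] -/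
theorem switch_count_congr (K K' : Finset HexVertex) (y : Site 2)
    (h : ∀ k : Fin 6, faceL y k ∈ K ↔ faceL y k ∈ K') :
    (Finset.univ.filter fun k : Fin 6 => faceL y k ∈ K ∧ faceL y (k + 1) ∉ K).card =
      (Finset.univ.filter fun k : Fin 6 => faceL y k ∈ K' ∧ faceL y (k + 1) ∉ K').card := by
  congr 1
  ext k
  simp only [Finset.mem_filter, Finset.mem_univ, true_and, h]

/-- **Gluing a grid trapezoid to tiles keeps the cell set pinch-free** (registered form, sub-goal of
`stub_innerPolygons`, FACT 1 pin part).  `S`: tile centres on the sublattice; `R`: the faces of the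
trapezoid `Y₀ ≤ v₁ ≤ Y₀ + H, X₀ - a ≤ v₀, (v₀ - X₀) + (v₁ - Y₀) ≤ b` (base row `Y₀`, base
`[X₀ - a, X₀ + b]`, `60°` base corners, height `H`, `120°` top corners; given by its membership test),
`1 ≤ H < a + b`; no tile face at the base corners `(X₀ - a, Y₀)`, `(X₀ + b, Y₀)`; all six faces in
tiles at the top corners `(X₀ - a, Y₀ + H)`, `(X₀ + b - H, Y₀ + H)`.  Then round every vertex at most
one anticlockwise switch out of `tileFaces S ∪ R`. [folklore] -/
theorem trapezoid_union_tiles_noPinch : ∀ (S : Finset (Site 2)) (R : Finset HexVertex) (a b H X₀ Y₀ : ℤ), (∀ c ∈ S, (c 0 - c 1) % 3 = 0) → (∀ F : HexVertex, F ∈ R ↔ ∀ v ∈ hexFaceVertices F, Y₀ ≤ v 1 ∧ v 1 ≤ Y₀ + H ∧ X₀ - a ≤ v 0 ∧ (v 0 - X₀) + (v 1 - Y₀) ≤ b) → 1 ≤ H → H < a + b → (∀ k : Fin 6, faceL ![X₀ - a, Y₀] k ∉ tileFaces S) → (∀ k : Fin 6, faceL ![X₀ + b, Y₀] k ∉ tileFaces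 S) → (∀ k : Fin 6, faceL ![X₀ - a, Y₀ + H] k ∈ tileFaces S) → (∀ k : Fin 6, faceL ![X₀ + b - H, Y₀ + H] k ∈ tileFaces S) → ∀ y : Site 2, (Finset.univ.filter fun k : Fin 6 => faceL y k ∈ tileFaces S ∪ R ∧ faceL y (k + 1) ∉ tileFaces S ∪ R).card ≤ 1 := by
  intro S R a b H X₀ Y₀ hS hR hH hab hcm hcp htl htr y
  -- the trapezoid test on a vertex
  let P : Site 2 → Prop := fun v => Y₀ ≤ v 1 ∧ v 1 ≤ Y₀ + H ∧ X₀ - a ≤ v 0 ∧ (v 0 - X₀) + (v 1 - Y₀) ≤ b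
  have hRy : ∀ k : Fin 6, faceL y k ∈ R ↔ P y ∧ P (y + triDir k) ∧ P (y + triDir (k + 1)) := by
    intro k
    rw [hR, hexFaceVertices_faceL]
    simp only [Finset.mem_insert, Finset.mem_singleton, forall_eq_or_imp, forall_eq]
    exact Iff.rfl
  obtain ⟨T, hT, hf⟩ := tile_pattern S hS y
  by_cases hPy : P y
  · -- `y` is a vertex of the closed trapezoid: tightness bits
    have hPy' := hPy
    obtain ⟨hy0, hyH, hyL, hyR⟩ := hPy
    set t0 : Bool := decide (y 1 = Y₀) with ht0
    set tH : Bool := decide (y 1 = Y₀ + H) with htH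
    set tL : Bool := decide (y 0 = X₀ - a) with htL
    set tR : Bool := decide ((y 0 - X₀) + (y 1 - Y₀) = b) with htR
    -- which neighbours leave the trapezoid
    have hfail : ∀ k : Fin 6, P (y + triDir k) ↔
        ((t0 && ![false, false, false, false, true, true] k) ||
          (tH && ![false, true, true, false, false, false] k) ||
          (tL && ![false, false, true, true, false, false] k) ||
          (tR && ![true, true, false, false, false, false] k)) = false := by
      intro k
      fin_cases k <;> simp [P, triDir, ht0, htH, htL, htR] <;> omega
    have h0H : (t0 && tH) = false := by
      simp only [ht0, htH, Bool.and_eq_false_imp, decide_eq_true_eq, decide_eq_false_iff_not]; omega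
    have hLR : (tL && tR) = false := by
      simp only [htL, htR, Bool.and_eq_false_imp, decide_eq_true_eq, decide_eq_false_iff_not]; omega
    have hcb : (t0 && (tL || tR)) = true → ∀ k, T k = false := by
      intro h k
      simp only [ht0, htL, htR, Bool.and_eq_true, Bool.or_eq_true, decide_eq_true_eq] at h
      have hy : y = ![X₀ - a, Y₀] ∨ y = ![X₀ + b, Y₀] := by
        rcases h.2 with h2 | h2
        · exact Or.inl ((site_two_eq_iff _ _).2 ⟨by simp [h2], by simp [h.1]⟩)
        · exact Or.inr ((site_two_eq_iff _ _).2 ⟨by simp; omega, by simp [h.1]⟩)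
      have : faceL y k ∉ tileFaces S := by
        rcases hy with rfl | rfl
        · exact hcm k
        · exact hcp k
      simpa using mt (hf k).2 this
    have hct : (tH && (tL || tR)) = true → ∀ k, T k = true := by
      intro h k
      simp only [htH, htL, htR, Bool.and_eq_true, Bool.or_eq_true, decide_eq_true_eq] at h
      have hy : y = ![X₀ - a, Y₀ + H] ∨ y = ![X₀ + b - H, Y₀ + H] := by
        rcases h.2 with h2 | h2
        · exact Or.inl ((site_two_eq_iff _ _).2 ⟨by simp [h2], by simp [h.1]⟩)
        · exact Or.inr ((site_two_eq_iff _ _).2 ⟨by simp; omega, by simp [h.1]⟩)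
      have : faceL y k ∈ tileFaces S := by
        rcases hy with rfl | rfl
        · exact htl k
        · exact htr k
      exact (hf k).1 this
    have hb := trapezoid_switch_le_one t0 tH tL tR T hT h0H hLR hcb hct
    -- the union pattern, pointwise
    have hM : ∀ k : Fin 6, faceL y k ∈ tileFaces S ∪ R ↔
        (T k || (!((t0 && ![false, false, false, false, true, true] k) ||
            (tH && ![false, true, true, false, false, false] k) ||
            (tL && ![false, false, true, true, false, false] k) ||
            (tR && ![true, true, false, false, false, false] k)) &&
          !((t0 && ![false, false, false, false, true, true] (k + 1)) ||
            (tH && ![false, true, true, false, false, false] (k + 1)) ||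
            (tL && ![false, false, true, true, false, false] (k + 1)) ||
            (tR && ![true, true, false, false, false, false] (k + 1))))) = true := by
      intro k
      rw [Finset.mem_union, hf, hRy, Bool.or_eq_true, Bool.and_eq_true, Bool.not_eq_true',
        Bool.not_eq_true', ← hfail k, ← hfail (k + 1)]
      simp only [hPy', true_and]
    convert hb using 2
    ext k
    simp only [Finset.mem_filter, Finset.mem_univ, true_and, hM, Bool.not_eq_true]
  · -- `y` off the closed trapezoid: only tiles matter
    have hRn : ∀ k : Fin 6, faceL y k ∉ R := fun k h => hPy ((hRy k).1 h).1
    have hb := superHexagons_noPinch S hS y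
    convert hb using 2
    ext k
    simp only [Finset.mem_filter, Finset.mem_univ, true_and, Finset.mem_union, hRn, or_false]

/-- **Two far-apart trapezoids** (the cell set `tileFaces S ∪ R₁ ∪ R₀` of the construction): if no
vertex has faces in both trapezoids, the no-pinch counts localise (`switch_count_congr`) and the
gluing theorem applies to each. [folklore] -/
theorem union_two_noPinch (S : Finset (Site 2)) (R₁ R₀ : Finset HexVertex)
    (h₁ : ∀ y : Site 2, (Finset.univ.filter fun k : Fin 6 =>
      faceL y k ∈ tileFaces S ∪ R₁ ∧ faceL y (k + 1) ∉ tileFaces S ∪ R₁).card ≤ 1)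
    (h₀ : ∀ y : Site 2, (Finset.univ.filter fun k : Fin 6 =>
      faceL y k ∈ tileFaces S ∪ R₀ ∧ faceL y (k + 1) ∉ tileFaces S ∪ R₀).card ≤ 1)
    (hsep : ∀ y : Site 2, (∀ k : Fin 6, faceL y k ∉ R₁) ∨ (∀ k : Fin 6, faceL y k ∉ R₀)) (y : Site 2) :
    (Finset.univ.filter fun k : Fin 6 =>
      faceL y k ∈ tileFaces S ∪ R₁ ∪ R₀ ∧ faceL y (k + 1) ∉ tileFaces S ∪ R₁ ∪ R₀).card ≤ 1 := by
  rcases hsep y with h | h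
  · rw [switch_count_congr (tileFaces S ∪ R₁ ∪ R₀) (tileFaces S ∪ R₀) y fun k => by
      simp only [Finset.mem_union, h k, or_false]]
    exact h₀ y
  · rw [switch_count_congr (tileFaces S ∪ R₁ ∪ R₀) (tileFaces S ∪ R₁) y fun k => by
      simp only [Finset.mem_union, h k, or_false]]
    exact h₁ y

end Summit.CriticalPhenomena.SAWScalingLimit.Theorems.PolygonParitySqueeze.BoundaryWalk

end
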